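import Literature.MathematicalPhysics.PowerSystems.LuriePostnikovSlabDualCompleteness
import Literature.MathematicalPhysics.PowerSystems.LuriePostnikovSlabPositivityDual
import HarnessLib

/-!
# Completeness of the dual-witness lane for the Lur'e–Postnikov POSITIVITY class: the theorem of
# STRONG alternatives for `LPSlabCertificate` (a positivity-class certificate with slopes `(a₀, b₀)`
# exists EXACTLY when no LP Farkas witness at `(a₀, b₀)` exists)

Topic `Literature/MathematicalPhysics/PowerSystems`, namespace
`Literature.MathematicalPhysics.PowerSystems.LyapunovFunctionFamily`.  Twin of
`LuriePostnikovSlabDualCompleteness.lean` (class of record `SlabCertificate`) for the WIDER,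
loop-transformed class `LPSlabCertificate` of `LuriePostnikovSlabPositivity.lean` (coercivity field
`P + Cᵀ·diag(λ_k a_k)·C − ε·1 ⪰ 0`, `P` itself free, no sign rule on `λ`), whose weak alternative is
`LuriePostnikovSlabPositivityDual.lean` (`LPSlabDualWitness`: (D1) `W + Wᵀ ⪰ 0`, (D2) `t_k ≥ 0`, (D3′)
`a₀_k q_k ≤ 2 s_k`, (D4) `a₀ < b₀`, `tr Z₁₁ > 0`; its docstring: «Strong alternatives are NOT
claimed»).  Everything below is PROVED (no named fact, no `sorry`, no new axiom); one new `structure`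
(a dual point).

## Source and what is printed

As in the twin file: S. Boyd, L. Vandenberghe, *Convex Optimization*, CUP 2004 [BoydVandenberghe2004]
(held `book:boydnd-convex-optimization`), §5.9.4 «Strong alternatives» (5.99)–(5.100) and
**Example 5.14** (strict LMI feasibility `F(x) ≺ 0` vs `Z ⪰ 0, Z ≠ 0, tr(GZ) ≥ 0, tr(FᵢZ) = 0`; «The
nonstrict inequality case is slightly more involved, and we need an extra assumption»), chunks
p0238–p0239 (printed pp. 269–270); §2.4.1 Examples 2.14–2.15 (chunk p0042), §2.5.1 / Example 2.19
(chunks p0044–p0046; Mathlib `geometric_hahn_banach_open_point`), §2.6.1 Example 2.24 (chunk p0048).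
The loop-transformed quadratic part `P + Cᵀ·diag(λa)·C`: H. K. Khalil, *Nonlinear Systems*, 3rd ed.,
§7.1 Example 7.5 with §7.1.2 Theorem 7.3 [Khalil2002] (as cited by the positivity files).

## What is typed

The typed class «an `LPSlabCertificate S` with slopes `a = a₀`, `b = b₀` exists» is the feasibility of
the MIXED conic system in `(P, η, λ, τ)`: STRICT `L(P, λ) := P + Cᵀ·diag(λ_k a₀_k)·C ≻ 0` and `η > 0`;
NON-STRICT `λ ≥ 0`, `τ ≥ 0`, `−𝓛(P, η, λ, τ, a₀, b₀) ⪰ 0`.  The separation runs in the same ambient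
space `Amb ι κ` as the twin, with the fourth slot fed `L(P, λ)` (linear in the data) instead of `P`;
reading the vanishing functional in the `λ = e_k` direction now produces the printed-lane condition
(D3′) `a₀_k q_k ≤ 2 s_k` EXACTLY (`q_k = (CWCᵀ)_kk` appears as `a₀_k (C·Y·Cᵀ)_kk` with `2Y = W + Wᵀ`).

* §1 `lpLower S a₀ P λ = P + Cᵀ·diag(λ_k a₀_k)·C` and its linearity / symmetry.
* §2 `LPSlabFarkasWitness S a₀ b₀` — `Z ⪰ 0`, (D1), (D2), (D3′) on every channel, nondegeneracy
  `0 < tr Z₁₁ ∨ W + Wᵀ ≠ 0`; `LPSlabDualWitness.toFarkas`; `LPSlabFarkasWitness.toSlabFarkas` (an LP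
  Farkas witness is a Farkas witness against the class of record, (D3′) ∧ (D1) ⇒ (D3) — consistent
  with `SlabCertificate.toLP`); the weak alternative at the slopes
  `LPSlabCertificate.false_of_lpFarkasWitness` (`tr(PW) = tr(LW) − Σ λ_k a₀_k q_k`, `tr(LW) ≥ 0` and
  `> 0` when `W + Wᵀ ≠ 0` since `L ⪰ ε·1`), `isEmpty_of_lpFarkasWitness`.
* §3 **`exists_lpFarkasWitness_of_isEmpty`** (strong half), `lp_isEmpty_iff_nonempty_lpFarkasWitness`,
  `exists_lpSlabCertificate_iff_not_nonempty_lpFarkasWitness`,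
  **`lpSlabCertificate_xor_lpFarkasWitness`** — EXACTLY ONE of: an `LPSlabCertificate S` with slopes
  `(a₀, b₀)` exists; an `LPSlabFarkasWitness S a₀ b₀` exists.  No hypothesis on `(A, B, C)` or on
  the slopes; no constraint qualification.

THREE COLUMNS.  CERTIFIED: statements about the certificate CLASS `LPSlabCertificate S` at fixed
slopes and its dual points (the lane of the cell's positivity-class rows).  VALIDATED: which
alternative holds for an instance is decided by solver-found exact data; nothing numerical here.
MODELLED: as the instance says.  Nothing here says a grid is stable or unstable.
-/

noncomputable section

open Matrix Finset

namespace Literature.MathematicalPhysics.PowerSystems.LyapunovFunctionFamily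

variable {ι κ : Type*} [Fintype ι] [Fintype κ] [DecidableEq ι] [DecidableEq κ]

/-! ## §1 The loop-transformed lower matrix as a linear function of the data -/

section Lower

variable (S : System ι κ) (a₀ : κ → ℝ)

/-- `L(P, λ) = P + Cᵀ·diag(λ_k a₀_k)·C`, the quadratic part of the loop-transformed Popov function at
slopes `a₀` (the matrix the positivity class asks to dominate `ε·1`; `LPSlabCertificate.lowerMatrix`
as a function of free data). [cite: Khalil2002, §7.1 Example 7.5 with §7.1.2 Theorem 7.3; Pai1981, §4.6 eq. (4.46)] -/
def lpLower (P : Matrix ι ι ℝ) (lam : κ → ℝ) : Matrix ι ι ℝ :=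
  P + S.Cᵀ * diagonal (fun k => lam k * a₀ k) * S.C

omit [DecidableEq ι] in
/-- `lpLower` is additive in `(P, λ)`. [cite: BoydVandenberghe2004, §5.9.4 Example 5.14 (an LMI is affine in its variables)] -/
theorem lpLower_add (P P' : Matrix ι ι ℝ) (lam lam' : κ → ℝ) :
    lpLower S a₀ (P + P') (lam + lam') = lpLower S a₀ P lam + lpLower S a₀ P' lam' := by
  have hd : diagonal (fun k => (lam + lam') k * a₀ k) =
      diagonal (fun k => lam k * a₀ k) + diagonal (fun k => lam' k * a₀ k) := by
    rw [diagonal_add]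
    congr 1
    funext k
    simp only [Pi.add_apply, add_mul]
  simp only [lpLower, hd, Matrix.mul_add, Matrix.add_mul]
  abel

omit [DecidableEq ι] in
/-- `lpLower` is homogeneous in `(P, λ)`. [cite: BoydVandenberghe2004, §5.9.4 Example 5.14 (an LMI is affine in its variables)] -/
theorem lpLower_smul (c : ℝ) (P : Matrix ι ι ℝ) (lam : κ → ℝ) :
    lpLower S a₀ (c • P) (c • lam) = c • lpLower S a₀ P lam := by
  have hd : diagonal (fun k => (c • lam) k * a₀ k) = c • diagonal (fun k => lam k * a₀ k) := by
    rw [← diagonal_smul]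
    congr 1
    funext k
    simp only [Pi.smul_apply, smul_eq_mul, mul_assoc]
  simp only [lpLower, hd, Matrix.mul_smul, Matrix.smul_mul, smul_add]

omit [DecidableEq ι] in
/-- `lpLower` is symmetric when `P` is. [cite: Khalil2002, §7.1.2 Theorem 7.3 (P = Pᵀ)] -/
theorem lpLower_transpose {P : Matrix ι ι ℝ} (hP : Pᵀ = P) (lam : κ → ℝ) :
    (lpLower S a₀ P lam)ᵀ = lpLower S a₀ P lam := by
  rw [lpLower, transpose_add, hP, transpose_mul, transpose_mul, transpose_transpose,
    diagonal_transpose, Matrix.mul_assoc]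

/-- For a certificate with slopes `a₀`, `lowerMatrix = lpLower S a₀ P λ`. [cite: Khalil2002, §7.1.2 Theorem 7.3] -/
theorem LPSlabCertificate.lowerMatrix_eq_lpLower {S : System ι κ} (Λ : LPSlabCertificate S)
    {a₀ : κ → ℝ} (ha : Λ.a = a₀) : Λ.lowerMatrix = lpLower S a₀ Λ.P Λ.lam := by
  rw [Λ.lowerMatrix_def, lpLower, ha]

omit [DecidableEq ι] in
/-- `tr(Y · Cᵀ·diag(d)·C) = Σ_k d_k (C·Y·Cᵀ)_kk` (the positivity block read through the trace pairing).
[cite: BoydVandenberghe2004, §5.9.4 (dual function of (5.96)); HornJohnson2013, §7.1 (cyclic trace)] -/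
theorem trace_mul_lowerBlock (Y : Matrix ι ι ℝ) (d : κ → ℝ) :
    trace (Y * (S.Cᵀ * diagonal d * S.C)) = ∑ k, d k * (S.C * Y * S.Cᵀ) k k := by
  rw [trace_mul_comm, trace_lowerBlock_mul]

end Lower

/-! ## §2 The LP Farkas witness and the weak alternative at the slopes -/

/-- **A Farkas witness against POSITIVITY-class certificates with slopes EXACTLY `(a₀, b₀)`**:
`Z = [[Z₁₁, Z₂₁ᵀ], [Z₂₁, Z₂₂]] ⪰ 0` with (D1) `W + Wᵀ ⪰ 0`, (D2) `t_k(a₀, b₀) ≥ 0`, (D3′)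
`a₀_k q_k ≤ 2 s_k` on every channel (`q_k = (CWCᵀ)_kk`), and the nondegeneracy
`0 < tr Z₁₁ ∨ W + Wᵀ ≠ 0` — `LPSlabDualWitness` minus the slope hypothesis `a₀ < b₀`, with
`tr Z₁₁ > 0` relaxed to the disjunction (what makes the alternative strong, §3).
[cite: BoydVandenberghe2004, §5.9.4 eqs. (5.99)–(5.100) and Example 5.14; Khalil2002, §7.1 Example 7.5 with §7.1.2 Theorem 7.3] -/
structure LPSlabFarkasWitness (S : System ι κ) (a₀ b₀ : κ → ℝ) where
  /-- state block of the dual matrix -/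
  Z₁₁ : Matrix ι ι ℝ
  /-- channel × state block of the dual matrix -/
  Z₂₁ : Matrix κ ι ℝ
  /-- channel block of the dual matrix -/
  Z₂₂ : Matrix κ κ ℝ
  /-- `Z ⪰ 0` -/
  psd : (fromBlocks Z₁₁ Z₂₁ᵀ Z₂₁ Z₂₂).PosSemidef
  /-- (D1) the symmetrised `P`-coefficient is PSD -/
  adjP_psd : (dualAdjP S Z₁₁ Z₂₁ + (dualAdjP S Z₁₁ Z₂₁)ᵀ).PosSemidef
  /-- (D2) the `τ_k`-coefficients at the slopes are nonnegative -/
  sectorCoeff_nonneg : ∀ k, 0 ≤ dualSectorCoeff S Z₁₁ Z₂₁ Z₂₂ a₀ b₀ k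
  /-- (D3′) the `λ_k`-coefficients over the positivity cone are nonnegative: `a₀_k q_k ≤ 2 s_k` -/
  lowerPopovCoeff_le : ∀ k, a₀ k * dualLowerCoeff S Z₁₁ Z₂₁ k ≤ 2 * dualPopovCoeff S Z₂₁ Z₂₂ k
  /-- nondegeneracy in a strict coordinate: `tr Z₁₁ > 0` or `W + Wᵀ ≠ 0` -/
  nondeg : 0 < trace Z₁₁ ∨ dualAdjP S Z₁₁ Z₂₁ + (dualAdjP S Z₁₁ Z₂₁)ᵀ ≠ 0

namespace LPSlabDualWitness

variable {S : System ι κ} {a₀ b₀ : κ → ℝ}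

/-- Every LP dual witness of `LuriePostnikovSlabPositivityDual` is an LP Farkas witness at its slopes.
[cite: BoydVandenberghe2004, §5.9.4 (5.100)] -/
def toFarkas (D : LPSlabDualWitness S a₀ b₀) : LPSlabFarkasWitness S a₀ b₀ where
  Z₁₁ := D.Z₁₁
  Z₂₁ := D.Z₂₁
  Z₂₂ := D.Z₂₂
  psd := D.psd
  adjP_psd := D.adjP_psd
  sectorCoeff_nonneg := D.sectorCoeff_nonneg
  lowerPopovCoeff_le := D.lowerPopovCoeff_le
  nondeg := Or.inl D.trace_pos

end LPSlabDualWitness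

namespace LPSlabFarkasWitness

variable {S : System ι κ} {a₀ b₀ : κ → ℝ} (D : LPSlabFarkasWitness S a₀ b₀)

omit [DecidableEq ι] [DecidableEq κ] in
/-- `q_k = C_k W C_kᵀ ≥ 0`: twice it is the compression of `W + Wᵀ ⪰ 0` along `C_kᵀ` (same proof as
`LPSlabDualWitness.lowerCoeff_nonneg`, for the relaxed structure). [cite: HornJohnson2013, §7.1 (7.1.1b) (`x*Ax ≥ 0`) with `x = C_kᵀ`] -/
private theorem lowerCoeff_nonneg_farkas (k : κ) : 0 ≤ dualLowerCoeff S D.Z₁₁ D.Z₂₁ k := by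
  have h := D.adjP_psd.dotProduct_mulVec_nonneg (S.C k)
  rw [star_trivial, Matrix.add_mulVec, dotProduct_add] at h
  set W := dualAdjP S D.Z₁₁ D.Z₂₁ with hW
  have b1 : S.C k ⬝ᵥ (W *ᵥ S.C k) = (S.C * W * S.Cᵀ) k k := by
    simp only [Matrix.mul_apply, Matrix.transpose_apply, dotProduct, Matrix.mulVec,
      Finset.mul_sum, Finset.sum_mul]
    rw [Finset.sum_comm]
    exact Finset.sum_congr rfl fun j _ => Finset.sum_congr rfl fun i _ => by ring
  have b2 : S.C k ⬝ᵥ (Wᵀ *ᵥ S.C k) = (S.C * W * S.Cᵀ) k k := by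
    simp only [Matrix.mul_apply, Matrix.transpose_apply, dotProduct, Matrix.mulVec,
      Finset.mul_sum, Finset.sum_mul]
    exact Finset.sum_congr rfl fun i _ => Finset.sum_congr rfl fun j _ => by ring
  rw [b1, b2] at h
  unfold dualLowerCoeff
  linarith

/-- **An LP Farkas witness is a Farkas witness against the class of record** (same blocks; (D3) on
the channels `0 ≤ a₀_k` from (D3′) and `q_k ≥ 0`) — consistent with `SlabCertificate.toLP` (old class
⊆ new class) and with `LPSlabDualWitness.toSlabDualWitness`.
[cite: BoydVandenberghe2004, §5.9.4 (5.99)–(5.100) and Example 5.14] -/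
def toSlabFarkas : SlabFarkasWitness S a₀ b₀ where
  Z₁₁ := D.Z₁₁
  Z₂₁ := D.Z₂₁
  Z₂₂ := D.Z₂₂
  psd := D.psd
  adjP_psd := D.adjP_psd
  sectorCoeff_nonneg := D.sectorCoeff_nonneg
  popovCoeff_nonneg := fun k hk => by
    have h1 := D.lowerPopovCoeff_le k
    have h2 := mul_nonneg hk (D.lowerCoeff_nonneg_farkas k)
    linarith
  nondeg := D.nondeg

end LPSlabFarkasWitness

namespace LPSlabCertificate

variable {S : System ι κ} (Λ : LPSlabCertificate S)

/-- **Weak alternative at the slopes (positivity class).**  An LP Farkas witness at `(a₀, b₀)` refutes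
every `LPSlabCertificate` whose slopes ARE `(a₀, b₀)`: `tr(Z·(−𝓛)) ≥ 0`, while
`tr(Z·𝓛) = tr(PW) + η·tr Z₁₁ + Σ τ_k t_k + 2Σ λ_k s_k` with `tr(PW) = tr(LW) − Σ λ_k a₀_k q_k`,
`tr(LW) = ½tr(L(W + Wᵀ)) ≥ 0` (`L = lowerMatrix ⪰ ε·1`), so
`tr(Z·𝓛) ≥ tr(LW) + η·tr Z₁₁ + Σ τ_k t_k + Σ λ_k(2 s_k − a₀_k q_k)` and one of the first two terms is `> 0`.
[cite: BoydVandenberghe2004, §5.9.4 eqs. (5.97)–(5.100) and Example 5.14; Khalil2002, §7.1.2 Theorem 7.3] -/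
theorem false_of_lpFarkasWitness {a₀ b₀ : κ → ℝ} (D : LPSlabFarkasWitness S a₀ b₀)
    (ha : Λ.a = a₀) (hb : Λ.b = b₀) : False := by
  have hZ₂₂ : D.Z₂₂ᵀ = D.Z₂₂ := by
    have h := (Matrix.isHermitian_fromBlocks_iff.mp D.psd.isHermitian).2.2.2
    simpa [Matrix.IsHermitian, Matrix.conjTranspose_eq_transpose_of_trivial] using h
  have hneg : trace (fromBlocks D.Z₁₁ D.Z₂₁ᵀ D.Z₂₁ D.Z₂₂ *
      slabMatrix S Λ.P Λ.η Λ.lam Λ.τ Λ.a Λ.b) ≤ 0 := by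
    have h := Literature.Computation.Certificates.trace_mul_nonneg_of_posSemidef D.psd Λ.lmi
    rw [Matrix.mul_neg, Matrix.trace_neg] at h
    linarith
  have hid := trace_dual_mul_slabMatrix S D.Z₁₁ D.Z₂₁ D.Z₂₂ hZ₂₂ Λ.P Λ.η Λ.lam Λ.τ Λ.a Λ.b
  set W := dualAdjP S D.Z₁₁ D.Z₂₁ with hWdef
  -- `2·tr(LW) = tr(L(W + Wᵀ)) ≥ 0`, `> 0` if `W + Wᵀ ≠ 0`
  have hsym : trace (Λ.lowerMatrix * Wᵀ) = trace (Λ.lowerMatrix * W) := by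
    rw [← Matrix.trace_transpose, Matrix.transpose_mul, Matrix.transpose_transpose,
      Λ.lowerMatrix_transpose, Matrix.trace_mul_comm]
  have h2LW : trace (Λ.lowerMatrix * (W + Wᵀ)) = 2 * trace (Λ.lowerMatrix * W) := by
    rw [Matrix.mul_add, Matrix.trace_add, hsym]
    ring
  have hLW : 0 ≤ trace (Λ.lowerMatrix * W) := by
    have h2 := Literature.Computation.Certificates.trace_mul_nonneg_of_posSemidef
      Λ.posSemidef_lowerMatrix D.adjP_psd
    rw [h2LW] at h2
    linarith
  -- `tr(PW) = tr(LW) − Σ λ_k a_k q_k`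
  have hsplit : trace (Λ.P * W) =
      trace (Λ.lowerMatrix * W) - ∑ k, Λ.lam k * Λ.a k * dualLowerCoeff S D.Z₁₁ D.Z₂₁ k := by
    rw [Λ.P_eq_lowerMatrix_sub, Matrix.sub_mul, Matrix.trace_sub, trace_lowerBlock_mul]
    rfl
  have hη : 0 ≤ Λ.η * trace D.Z₁₁ :=
    mul_nonneg Λ.η_pos.le (D.psd.submatrix Sum.inl).trace_nonneg
  have hτ : 0 ≤ ∑ k, Λ.τ k * dualSectorCoeff S D.Z₁₁ D.Z₂₁ D.Z₂₂ Λ.a Λ.b k := by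
    rw [ha, hb]
    exact Finset.sum_nonneg fun k _ => mul_nonneg (Λ.τ_nonneg k) (D.sectorCoeff_nonneg k)
  have hl : 0 ≤ ∑ k, (2 * (Λ.lam k * dualPopovCoeff S D.Z₂₁ D.Z₂₂ k)
      - Λ.lam k * Λ.a k * dualLowerCoeff S D.Z₁₁ D.Z₂₁ k) := by
    refine Finset.sum_nonneg fun k _ => ?_
    have h1 := D.lowerPopovCoeff_le k
    have e : 2 * (Λ.lam k * dualPopovCoeff S D.Z₂₁ D.Z₂₂ k)
        - Λ.lam k * Λ.a k * dualLowerCoeff S D.Z₁₁ D.Z₂₁ k =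
        Λ.lam k * (2 * dualPopovCoeff S D.Z₂₁ D.Z₂₂ k - a₀ k * dualLowerCoeff S D.Z₁₁ D.Z₂₁ k) := by
      rw [ha]; ring
    rw [e]
    exact mul_nonneg (Λ.lam_nonneg k) (by linarith)
  have hsum : ∑ k, (2 * (Λ.lam k * dualPopovCoeff S D.Z₂₁ D.Z₂₂ k)
      - Λ.lam k * Λ.a k * dualLowerCoeff S D.Z₁₁ D.Z₂₁ k) =
      2 * ∑ k, Λ.lam k * dualPopovCoeff S D.Z₂₁ D.Z₂₂ k
        - ∑ k, Λ.lam k * Λ.a k * dualLowerCoeff S D.Z₁₁ D.Z₂₁ k := by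
    rw [Finset.sum_sub_distrib, Finset.mul_sum]
  rcases D.nondeg with htr | hW
  · have hη' : 0 < Λ.η * trace D.Z₁₁ := mul_pos Λ.η_pos htr
    linarith
  · have hLW' : 0 < trace (Λ.lowerMatrix * W) := by
      have h2 := trace_mul_pos_of_sub_smul_posSemidef Λ.ε_pos Λ.lowerMatrix_ge D.adjP_psd hW
      rw [h2LW] at h2
      linarith
    linarith

/-- Set form: an LP Farkas witness at `(a₀, b₀)` empties the positivity class at these slopes.
[cite: BoydVandenberghe2004, §5.9.4 (5.99)–(5.100) and Example 5.14] -/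
theorem isEmpty_of_lpFarkasWitness {a₀ b₀ : κ → ℝ} (D : LPSlabFarkasWitness S a₀ b₀) :
    IsEmpty {Λ : LPSlabCertificate S // Λ.a = a₀ ∧ Λ.b = b₀} :=
  ⟨fun ⟨Λ, ha, hb⟩ => Λ.false_of_lpFarkasWitness D ha hb⟩

/-- … and, through `toSlabFarkas`, the class of record at these slopes as well.
[cite: BoydVandenberghe2004, §5.9.4 (5.99)–(5.100) and Example 5.14] -/
theorem _root_.Literature.MathematicalPhysics.PowerSystems.LyapunovFunctionFamily.SlabCertificate.false_of_lpFarkasWitness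
    {a₀ b₀ : κ → ℝ} (Λ' : SlabCertificate S) (D : LPSlabFarkasWitness S a₀ b₀)
    (ha : Λ'.a = a₀) (hb : Λ'.b = b₀) : False :=
  Λ'.false_of_farkasWitness D.toSlabFarkas ha hb

end LPSlabCertificate

/-! ## §3 The strong alternative for the positivity class -/

section RealFacts

/-- If `s·a + K > 0` for every `s > 0` then `a ≥ 0`. [folklore] -/
private theorem nonneg_of_forall_pos_mul_add_pos' {a K : ℝ} (h : ∀ s : ℝ, 0 < s → 0 < s * a + K) :
    0 ≤ a := by
  by_contra ha
  have ha : a < 0 := not_le.mp ha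
  have hs : 0 < (|K| + 1) / (-a) := div_pos (by positivity) (neg_pos.mpr ha)
  have h1 := h _ hs
  have e : (|K| + 1) / (-a) * a = -(|K| + 1) := by
    rw [div_mul_eq_mul_div, mul_div_assoc, div_neg, div_self ha.ne, mul_neg_one]
  rw [e] at h1
  linarith [le_abs_self K]

/-- If `a + t·b ≥ 0` for every `t > 0` then `a ≥ 0`. [folklore] -/
private theorem nonneg_of_forall_pos_add_mul_nonneg' {a b : ℝ}
    (h : ∀ t : ℝ, 0 < t → 0 ≤ a + t * b) : 0 ≤ a := by
  by_contra ha
  have ha : a < 0 := not_le.mp ha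
  have hpos : 0 < |b| + 1 := by positivity
  have ht : 0 < (-a) / (2 * (|b| + 1)) := div_pos (neg_pos.mpr ha) (by positivity)
  have h1 := h _ ht
  have hb : (-a) / (2 * (|b| + 1)) * b ≤ (-a) / 2 := by
    have h2 : (-a) / (2 * (|b| + 1)) * b ≤ (-a) / (2 * (|b| + 1)) * (|b| + 1) :=
      mul_le_mul_of_nonneg_left ((le_abs_self b).trans (by linarith)) ht.le
    have e : (-a) / (2 * (|b| + 1)) * (|b| + 1) = (-a) / 2 := by
      have hne : |b| + 1 ≠ 0 := hpos.ne'
      field_simp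
    linarith
  linarith

variable {n : Type*} [Fintype n] [DecidableEq n]

/-- `Σ_j e_k(j)·g(j) = g(k)`. [folklore] -/
private theorem sum_single_one_mul' (k : n) (g : n → ℝ) :
    ∑ j, Pi.single (M := fun _ : n => ℝ) k (1 : ℝ) j * g j = g k := by
  rw [Finset.sum_eq_single k]
  · simp
  · intro j _ hj
    simp [hj]
  · intro hk
    exact absurd (Finset.mem_univ k) hk

/-- `tr(E_ij · M) = M_ji`. [folklore] -/
private theorem trace_single_one_mul' (i j : n) (M : Matrix n n ℝ) :
    trace (single i j (1 : ℝ) * M) = M j i := by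
  rw [Matrix.trace_single_mul, smul_eq_mul, one_mul]

/-- `tr(M · E_ij) = M_ji`. [folklore] -/
private theorem trace_mul_single_one' (i j : n) (M : Matrix n n ℝ) :
    trace (M * single i j (1 : ℝ)) = M j i := by
  rw [trace_mul_comm, trace_single_one_mul']

omit [DecidableEq n] in
/-- For symmetric `M`: `tr((Z + Zᵀ)M) = 2·tr(ZM)`. [folklore] -/
private theorem trace_add_transpose_mul_of_symm' (Z : Matrix n n ℝ) {M : Matrix n n ℝ}
    (hM : Mᵀ = M) : trace ((Z + Zᵀ) * M) = 2 * trace (Z * M) := by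
  have h : trace (Zᵀ * M) = trace (Z * M) := by
    rw [← trace_transpose, transpose_mul, transpose_transpose, hM, trace_mul_comm]
  rw [Matrix.add_mul, trace_add, h]
  ring

omit [DecidableEq n] in
/-- Diagonal entries of `C·Mᵀ·Cᵀ` and `C·M·Cᵀ` agree. [folklore] -/
private theorem conj_transpose_diag_eq {m : Type*} [Fintype m] (C : Matrix m n ℝ) (M : Matrix n n ℝ)
    (k : m) : (C * Mᵀ * Cᵀ) k k = (C * M * Cᵀ) k k := by
  have h : C * Mᵀ * Cᵀ = (C * M * Cᵀ)ᵀ := by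
    rw [transpose_mul, transpose_mul, transpose_transpose, Matrix.mul_assoc]
  rw [h, transpose_apply]

end RealFacts

section Main

variable (S : System ι κ) (a₀ b₀ : κ → ℝ)

/-- The primal point of the positivity class: (`−𝓛(P, η, λ, τ, a₀, b₀)`, `λ`, `τ`, `L(P, λ)`, `η`).
[cite: BoydVandenberghe2004, §5.9.4 (5.99)–(5.101)] -/
def lpPrimalPoint (P : Matrix ι ι ℝ) (η : ℝ) (lam τ : κ → ℝ) : Amb ι κ :=
  (-slabMatrix S P η lam τ a₀ b₀, lam, τ, lpLower S a₀ P lam, η)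

/-- `lpPrimalPoint` is additive. [cite: BoydVandenberghe2004, §5.9.4 Example 5.14] -/
theorem lpPrimalPoint_add (P P' : Matrix ι ι ℝ) (η η' : ℝ) (lam lam' τ τ' : κ → ℝ) :
    lpPrimalPoint S a₀ b₀ (P + P') (η + η') (lam + lam') (τ + τ') =
      lpPrimalPoint S a₀ b₀ P η lam τ + lpPrimalPoint S a₀ b₀ P' η' lam' τ' := by
  simp only [lpPrimalPoint, lpLower_add, slabMatrix_add, neg_add, Prod.mk_add_mk]

/-- `lpPrimalPoint` is homogeneous. [cite: BoydVandenberghe2004, §5.9.4 Example 5.14] -/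
theorem lpPrimalPoint_smul (c : ℝ) (P : Matrix ι ι ℝ) (η : ℝ) (lam τ : κ → ℝ) :
    lpPrimalPoint S a₀ b₀ (c • P) (c * η) (c • lam) (c • τ) = c • lpPrimalPoint S a₀ b₀ P η lam τ := by
  rw [lpPrimalPoint, lpPrimalPoint, lpLower_smul, slabMatrix_smul]
  simp only [Prod.smul_mk, smul_neg, smul_eq_mul]

/-- `lpPrimalPoint 0 = 0`. [cite: BoydVandenberghe2004, §5.9.4 Example 5.14] -/
theorem lpPrimalPoint_zero : lpPrimalPoint S a₀ b₀ 0 0 0 0 = 0 := by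
  have h := lpPrimalPoint_smul S a₀ b₀ 0 0 0 0 0
  simp only [zero_smul, zero_mul] at h
  exact h

/-- The separated set of the positivity class.
[cite: BoydVandenberghe2004, §5.9.4 (proof of the strong alternative for (5.99)) and §2.5.1] -/
def lpSepSet : Set (Amb ι κ) :=
  {e | ∃ (P : Matrix ι ι ℝ) (η : ℝ) (lam τ : κ → ℝ),
    Pᵀ = P ∧ lpPrimalPoint S a₀ b₀ P η lam τ - e ∈ strictCone ι κ}

/-- `lpSepSet` is open. [cite: BoydVandenberghe2004, §2.5.1 and Example 2.19] -/
theorem isOpen_lpSepSet : IsOpen (lpSepSet S a₀ b₀) := by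
  rw [isOpen_iff_forall_mem_open]
  rintro e ⟨P, η, lam, τ, hP, he⟩
  refine ⟨(fun e' => lpPrimalPoint S a₀ b₀ P η lam τ - e') ⁻¹' strictCone ι κ, ?_, ?_, he⟩
  · intro e' he'
    exact ⟨P, η, lam, τ, hP, he'⟩
  · exact isOpen_strictCone.preimage (continuous_const.sub continuous_id)

/-- `lpSepSet` is convex. [cite: BoydVandenberghe2004, §2.3.2 and §2.5.1] -/
theorem convex_lpSepSet : Convex ℝ (lpSepSet S a₀ b₀) := by
  rintro e₁ ⟨P₁, η₁, l₁, τ₁, hP₁, h₁⟩ e₂ ⟨P₂, η₂, l₂, τ₂, hP₂, h₂⟩ θ₁ θ₂ hθ₁ hθ₂ hθ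
  refine ⟨θ₁ • P₁ + θ₂ • P₂, θ₁ * η₁ + θ₂ * η₂, θ₁ • l₁ + θ₂ • l₂, θ₁ • τ₁ + θ₂ • τ₂, ?_, ?_⟩
  · rw [transpose_add, transpose_smul, transpose_smul, hP₁, hP₂]
  · have e : lpPrimalPoint S a₀ b₀ (θ₁ • P₁ + θ₂ • P₂) (θ₁ * η₁ + θ₂ * η₂) (θ₁ • l₁ + θ₂ • l₂)
          (θ₁ • τ₁ + θ₂ • τ₂) - (θ₁ • e₁ + θ₂ • e₂) =
        θ₁ • (lpPrimalPoint S a₀ b₀ P₁ η₁ l₁ τ₁ - e₁) +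
          θ₂ • (lpPrimalPoint S a₀ b₀ P₂ η₂ l₂ τ₂ - e₂) := by
      rw [lpPrimalPoint_add, lpPrimalPoint_smul, lpPrimalPoint_smul, smul_sub, smul_sub]
      abel
    rw [e]
    exact convex_strictCone h₁ h₂ hθ₁ hθ₂ hθ

/-- If no positivity certificate with slopes `(a₀, b₀)` exists then `0 ∉ lpSepSet`.
[cite: BoydVandenberghe2004, §5.9.4 (infeasibility of (5.99) ⇒ the optimal value of (5.101) is nonnegative)] -/
theorem zero_not_mem_lpSepSet (h : IsEmpty {Λ : LPSlabCertificate S // Λ.a = a₀ ∧ Λ.b = b₀}) :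
    (0 : Amb ι κ) ∉ lpSepSet S a₀ b₀ := by
  rintro ⟨P, η, lam, τ, hP, hmem⟩
  rw [sub_zero, lpPrimalPoint, mem_strictCone_iff] at hmem
  obtain ⟨hL, hlam, hτ, hPc, hη⟩ := hmem
  obtain ⟨ε, hε, hPε⟩ := exists_pos_sub_smul_one_posSemidef_of_mem (lpLower_transpose S a₀ hP lam) hPc
  have hsymL : (-slabMatrix S P η lam τ a₀ b₀)ᵀ = -slabMatrix S P η lam τ a₀ b₀ :=
    neg_slabMatrix_transpose S hP η lam τ a₀ b₀
  have hlmi := (posDef_of_mem_quadPosCone hsymL hL).posSemidef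
  let Λ : LPSlabCertificate S :=
    { P := P, ε := ε, η := η, τ := τ, lam := lam, a := a₀, b := b₀,
      P_symm := hP, ε_pos := hε, η_pos := hη, lower_ge := hPε,
      τ_nonneg := fun k => (hτ k).le,
      lam_nonneg := fun k => (hlam k).le,
      lmi := hlmi }
  exact h.false ⟨Λ, rfl, rfl⟩

/-- **THE STRONG ALTERNATIVE for the positivity class.**  If NO `LPSlabCertificate S` has slopes
`(a₀, b₀)`, an LP Farkas witness at `(a₀, b₀)` EXISTS.  Same separation as the twin, fourth slot fed
`L(P, λ)`; the `λ = e_k` direction of the vanishing functional yields (D3′) `a₀_k q_k ≤ 2 s_k`.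
[cite: BoydVandenberghe2004, §5.9.4 «Strong alternatives» (5.99)–(5.102) and Example 5.14; §2.5.1] -/
theorem exists_lpFarkasWitness_of_isEmpty
    (h : IsEmpty {Λ : LPSlabCertificate S // Λ.a = a₀ ∧ Λ.b = b₀}) :
    Nonempty (LPSlabFarkasWitness S a₀ b₀) := by
  classical
  obtain ⟨f₀, hf₀⟩ := geometric_hahn_banach_open_point (convex_lpSepSet S a₀ b₀)
    (isOpen_lpSepSet S a₀ b₀) (zero_not_mem_lpSepSet S a₀ b₀ h)
  set f : Amb ι κ →ₗ[ℝ] ℝ := (f₀ : Amb ι κ →ₗ[ℝ] ℝ) with hf_def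
  have hf : ∀ e ∈ lpSepSet S a₀ b₀, f e < 0 := fun e he => by
    have := hf₀ e he
    rw [map_zero] at this
    exact this
  have hc₀ : ((1, 1, 1, 1, 1) : Amb ι κ) ∈ strictCone ι κ := by
    rw [mem_strictCone_iff]
    exact ⟨one_mem_quadPosCone, one_mem_posOrthant, one_mem_posOrthant, one_mem_quadPosCone,
      one_pos⟩
  -- Step 1
  have step1 : ∀ (P : Matrix ι ι ℝ) (η : ℝ) (lam τ : κ → ℝ), Pᵀ = P →
      ∀ c ∈ strictCone ι κ, f (lpPrimalPoint S a₀ b₀ P η lam τ) < f c := by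
    intro P η lam τ hP c hc
    have hmem : lpPrimalPoint S a₀ b₀ P η lam τ - c ∈ lpSepSet S a₀ b₀ :=
      ⟨P, η, lam, τ, hP, by rwa [sub_sub_cancel]⟩
    have := hf _ hmem
    rw [map_sub] at this
    linarith
  -- Step 2
  have step2 : ∀ (P : Matrix ι ι ℝ) (η : ℝ) (lam τ : κ → ℝ), Pᵀ = P →
      f (lpPrimalPoint S a₀ b₀ P η lam τ) = 0 := by
    intro P η lam τ hP
    by_contra hne
    have key : ∀ r : ℝ, r * f (lpPrimalPoint S a₀ b₀ P η lam τ) < f (1, 1, 1, 1, 1) := by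
      intro r
      have hsym : (r • P)ᵀ = r • P := by rw [transpose_smul, hP]
      have := step1 (r • P) (r * η) (r • lam) (r • τ) hsym _ hc₀
      rwa [lpPrimalPoint_smul, map_smul, smul_eq_mul] at this
    have := key ((f (1, 1, 1, 1, 1) + 1) / f (lpPrimalPoint S a₀ b₀ P η lam τ))
    rw [div_mul_cancel₀ _ hne] at this
    linarith
  -- Step 3
  have step3 : ∀ c ∈ strictCone ι κ, 0 < f c := by
    intro c hc
    have := step1 0 0 0 0 transpose_zero c hc
    rwa [lpPrimalPoint_zero, map_zero] at this
  have hc₀pos := step3 _ hc₀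
  -- dual data
  set Zh : Matrix (ι ⊕ κ) (ι ⊕ κ) ℝ := reprMatrix (slotZ f) with hZh
  set Zs : Matrix (ι ⊕ κ) (ι ⊕ κ) ℝ := Zh + Zhᵀ with hZs
  set Yh : Matrix ι ι ℝ := reprMatrix (slotP f) with hYh
  set Ys : Matrix ι ι ℝ := Yh + Yhᵀ with hYs
  have hZpair : ∀ M : Matrix (ι ⊕ κ) (ι ⊕ κ) ℝ, Mᵀ = M → trace (Zs * M) = 2 * slotZ f M := by
    intro M hM
    rw [hZs, trace_add_transpose_mul_of_symm' Zh hM, hZh, trace_reprMatrix_mul]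
  have hYpair : ∀ M : Matrix ι ι ℝ, Mᵀ = M → trace (Ys * M) = 2 * slotP f M := by
    intro M hM
    rw [hYs, trace_add_transpose_mul_of_symm' Yh hM, hYh, trace_reprMatrix_mul]
  have hR : ∀ r : ℝ, slotR f r = r * slotR f 1 := by
    intro r
    have : slotR f r = slotR f (r • (1 : ℝ)) := by rw [smul_eq_mul, mul_one]
    rw [this, map_smul, smul_eq_mul]
  have hZs_symm : Zsᵀ = Zs := by rw [hZs, transpose_add, transpose_transpose, add_comm]
  have hYs_symm : Ysᵀ = Ys := by rw [hYs, transpose_add, transpose_transpose, add_comm]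
  -- (i) signs
  have hZnonneg : ∀ M : Matrix (ι ⊕ κ) (ι ⊕ κ) ℝ, M ∈ quadPosCone (ι ⊕ κ) → 0 ≤ slotZ f M := by
    intro M hM
    refine nonneg_of_forall_pos_mul_add_pos' (K := f (1, 1, 1, 1, 1)) fun s hs => ?_
    have hc : ((1 + s • M, 1, 1, 1, 1) : Amb ι κ) ∈ strictCone ι κ := by
      rw [mem_strictCone_iff]
      exact ⟨add_mem_quadPosCone one_mem_quadPosCone (smul_mem_quadPosCone hs hM),
        one_mem_posOrthant, one_mem_posOrthant, one_mem_quadPosCone, one_pos⟩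
    have e : ((1 + s • M, 1, 1, 1, 1) : Amb ι κ) = (1, 1, 1, 1, 1) + (s • M, 0) := by simp
    have h2 : f ((s • M, 0) : Amb ι κ) = s * slotZ f M := by
      rw [show f ((s • M, 0) : Amb ι κ) = slotZ f (s • M) from rfl, map_smul, smul_eq_mul]
    have := step3 _ hc
    rw [e, map_add, h2] at this
    linarith
  have hZpsd_arg : ∀ M : Matrix (ι ⊕ κ) (ι ⊕ κ) ℝ, M.PosSemidef → 0 ≤ trace (Zh * M) := by
    intro M hM
    rw [hZh, trace_reprMatrix_mul]
    refine nonneg_of_forall_pos_add_mul_nonneg' (b := slotZ f 1) fun t ht => ?_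
    have := hZnonneg _ (add_smul_one_mem_quadPosCone hM ht)
    rwa [map_add, map_smul, smul_eq_mul] at this
  have hZs_psd : Zs.PosSemidef := posSemidef_add_transpose_of_nonneg hZpsd_arg
  have hPnonneg : ∀ M : Matrix ι ι ℝ, M ∈ quadPosCone ι → 0 ≤ slotP f M := by
    intro M hM
    refine nonneg_of_forall_pos_mul_add_pos' (K := f (1, 1, 1, 1, 1)) fun s hs => ?_
    have hc : ((1, 1, 1, 1 + s • M, 1) : Amb ι κ) ∈ strictCone ι κ := by
      rw [mem_strictCone_iff]
      exact ⟨one_mem_quadPosCone, one_mem_posOrthant, one_mem_posOrthant,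
        add_mem_quadPosCone one_mem_quadPosCone (smul_mem_quadPosCone hs hM), one_pos⟩
    have e : ((1, 1, 1, 1 + s • M, 1) : Amb ι κ) = (1, 1, 1, 1, 1) + (0, 0, 0, s • M, 0) := by simp
    have h2 : f ((0, 0, 0, s • M, 0) : Amb ι κ) = s * slotP f M := by
      rw [show f ((0, 0, 0, s • M, 0) : Amb ι κ) = slotP f (s • M) from rfl, map_smul, smul_eq_mul]
    have := step3 _ hc
    rw [e, map_add, h2] at this
    linarith
  have hYpsd_arg : ∀ M : Matrix ι ι ℝ, M.PosSemidef → 0 ≤ trace (Yh * M) := by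
    intro M hM
    rw [hYh, trace_reprMatrix_mul]
    refine nonneg_of_forall_pos_add_mul_nonneg' (b := slotP f 1) fun t ht => ?_
    have := hPnonneg _ (add_smul_one_mem_quadPosCone hM ht)
    rwa [map_add, map_smul, smul_eq_mul] at this
  have hYs_psd : Ys.PosSemidef := posSemidef_add_transpose_of_nonneg hYpsd_arg
  have hμ_nonneg : ∀ k, 0 ≤ slotV f (Pi.single k 1) := by
    intro k
    refine nonneg_of_forall_pos_mul_add_pos' (K := f (1, 1, 1, 1, 1)) fun s hs => ?_
    have hc : ((1, 1 + s • Pi.single k 1, 1, 1, 1) : Amb ι κ) ∈ strictCone ι κ := by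
      rw [mem_strictCone_iff]
      exact ⟨one_mem_quadPosCone, one_add_single_mem_posOrthant k hs, one_mem_posOrthant,
        one_mem_quadPosCone, one_pos⟩
    have e : ((1, 1 + s • Pi.single k 1, 1, 1, 1) : Amb ι κ) =
        (1, 1, 1, 1, 1) + (0, s • Pi.single k 1, 0) := by simp
    have h2 : f ((0, s • Pi.single k 1, 0) : Amb ι κ) = s * slotV f (Pi.single k 1) := by
      rw [show f ((0, s • Pi.single k 1, 0) : Amb ι κ) = slotV f (s • Pi.single k 1) from rfl,
        map_smul, smul_eq_mul]
    have := step3 _ hc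
    rw [e, map_add, h2] at this
    linarith
  have hν_nonneg : ∀ k, 0 ≤ slotW f (Pi.single k 1) := by
    intro k
    refine nonneg_of_forall_pos_mul_add_pos' (K := f (1, 1, 1, 1, 1)) fun s hs => ?_
    have hc : ((1, 1, 1 + s • Pi.single k 1, 1, 1) : Amb ι κ) ∈ strictCone ι κ := by
      rw [mem_strictCone_iff]
      exact ⟨one_mem_quadPosCone, one_mem_posOrthant, one_add_single_mem_posOrthant k hs,
        one_mem_quadPosCone, one_pos⟩
    have e : ((1, 1, 1 + s • Pi.single k 1, 1, 1) : Amb ι κ) =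
        (1, 1, 1, 1, 1) + (0, 0, s • Pi.single k 1, 0) := by simp
    have h2 : f ((0, 0, s • Pi.single k 1, 0) : Amb ι κ) = s * slotW f (Pi.single k 1) := by
      rw [show f ((0, 0, s • Pi.single k 1, 0) : Amb ι κ) = slotW f (s • Pi.single k 1) from rfl,
        map_smul, smul_eq_mul]
    have := step3 _ hc
    rw [e, map_add, h2] at this
    linarith
  -- (ii) blocks
  set Z₁₁ : Matrix ι ι ℝ := Zs.toBlocks₁₁ with hZ11
  set Z₂₁ : Matrix κ ι ℝ := Zs.toBlocks₂₁ with hZ21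
  set Z₂₂ : Matrix κ κ ℝ := Zs.toBlocks₂₂ with hZ22
  have hblocks : fromBlocks Z₁₁ Z₂₁ᵀ Z₂₁ Z₂₂ = Zs := by
    have h12 : Zs.toBlocks₁₂ = Z₂₁ᵀ := by
      ext i j
      have hs := congrFun (congrFun hZs_symm (Sum.inl i)) (Sum.inr j)
      rw [transpose_apply] at hs
      simp only [hZ21, toBlocks₁₂, toBlocks₂₁, transpose_apply, of_apply]
      exact hs.symm
    rw [← h12, hZ11, hZ21, hZ22, fromBlocks_toBlocks]
  have hZ22symm : Z₂₂ᵀ = Z₂₂ := by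
    ext i j
    have hs := congrFun (congrFun hZs_symm (Sum.inr i)) (Sum.inr j)
    rw [transpose_apply] at hs
    simp only [hZ22, toBlocks₂₂, transpose_apply, of_apply]
    exact hs
  have hZ11_psd : Z₁₁.PosSemidef := hZs_psd.submatrix Sum.inl
  have hZ22_psd : Z₂₂.PosSemidef := hZs_psd.submatrix Sum.inr
  -- (iii) the vanishing identity
  have hvan : ∀ (P : Matrix ι ι ℝ) (η : ℝ) (lam τ : κ → ℝ), Pᵀ = P →
      -(trace (P * dualAdjP S Z₁₁ Z₂₁) + η * trace Z₁₁
          + ∑ k, τ k * dualSectorCoeff S Z₁₁ Z₂₁ Z₂₂ a₀ b₀ k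
          + 2 * ∑ k, lam k * dualPopovCoeff S Z₂₁ Z₂₂ k)
        + 2 * slotV f lam + 2 * slotW f τ
        + (trace (Ys * P) + ∑ k, (lam k * a₀ k) * (S.C * Ys * S.Cᵀ) k k)
        + 2 * (η * slotR f 1) = 0 := by
    intro P η lam τ hP
    have h0 := step2 P η lam τ hP
    rw [lpPrimalPoint, apply_eq_slots, map_neg] at h0
    have hLsym := slabMatrix_transpose S hP η lam τ a₀ b₀
    have h1 := hZpair _ hLsym
    rw [← hblocks, trace_dual_mul_slabMatrix S Z₁₁ Z₂₁ Z₂₂ hZ22symm] at h1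
    have h2 := hYpair (lpLower S a₀ P lam) (lpLower_transpose S a₀ hP lam)
    have h2' : trace (Ys * lpLower S a₀ P lam) =
        trace (Ys * P) + ∑ k, (lam k * a₀ k) * (S.C * Ys * S.Cᵀ) k k := by
      rw [lpLower, Matrix.mul_add, trace_add, trace_mul_lowerBlock]
    have h3 := hR η
    linarith
  -- (V1)
  have hV1 : trace Z₁₁ = 2 * slotR f 1 := by
    have h := hvan 0 1 0 0 transpose_zero
    simp only [trace_zero, Pi.zero_apply, zero_mul, Finset.sum_const_zero,
      map_zero, mul_zero, add_zero, one_mul, zero_add] at h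
    linarith
  -- (V2)
  have hV2 : ∀ k, dualSectorCoeff S Z₁₁ Z₂₁ Z₂₂ a₀ b₀ k = 2 * slotW f (Pi.single k 1) := by
    intro k
    have h := hvan 0 0 0 (Pi.single k 1) transpose_zero
    simp only [trace_zero, zero_mul, Pi.zero_apply, Finset.sum_const_zero,
      map_zero, mul_zero, add_zero, zero_add, sum_single_one_mul'] at h
    linarith
  -- (V4) first: `W + Wᵀ = 2Y`
  have hV4 : dualAdjP S Z₁₁ Z₂₁ + (dualAdjP S Z₁₁ Z₂₁)ᵀ = Ys + Ys := by
    ext i j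
    have hPsym : (single i j (1 : ℝ) + single j i 1)ᵀ = single i j 1 + single j i 1 := by
      rw [transpose_add, transpose_single, transpose_single, add_comm]
    have h := hvan (single i j 1 + single j i 1) 0 0 0 hPsym
    simp only [zero_mul, Pi.zero_apply, Finset.sum_const_zero, map_zero,
      mul_zero, add_zero, Matrix.add_mul, Matrix.mul_add, trace_add, trace_single_one_mul',
      trace_mul_single_one'] at h
    have hYsym : Ys j i = Ys i j := by
      have hs := congrFun (congrFun hYs_symm i) j
      rwa [transpose_apply] at hs
    simp only [Matrix.add_apply, transpose_apply]
    linarith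
  -- `(C·Y·Cᵀ)_kk = q_k`
  have hq : ∀ k, (S.C * Ys * S.Cᵀ) k k = dualLowerCoeff S Z₁₁ Z₂₁ k := by
    intro k
    have h2 : (S.C * (Ys + Ys) * S.Cᵀ) k k =
        (S.C * (dualAdjP S Z₁₁ Z₂₁ + (dualAdjP S Z₁₁ Z₂₁)ᵀ) * S.Cᵀ) k k := by rw [hV4]
    simp only [Matrix.mul_add, Matrix.add_mul, Matrix.add_apply, conj_transpose_diag_eq] at h2
    unfold dualLowerCoeff
    linarith
  -- (V3′) `a₀_k q_k = 2 s_k − 2 μ_k`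
  have hV3 : ∀ k, a₀ k * dualLowerCoeff S Z₁₁ Z₂₁ k =
      2 * dualPopovCoeff S Z₂₁ Z₂₂ k - 2 * slotV f (Pi.single k 1) := by
    intro k
    have h := hvan 0 0 (Pi.single k 1) 0 transpose_zero
    simp only [trace_zero, zero_mul, Pi.zero_apply, Finset.sum_const_zero,
      map_zero, mul_zero, add_zero, zero_add, sum_single_one_mul'] at h
    have hs : ∑ j, Pi.single (M := fun _ : κ => ℝ) k (1 : ℝ) j * a₀ j * (S.C * Ys * S.Cᵀ) j j =
        a₀ k * (S.C * Ys * S.Cᵀ) k k := by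
      have := sum_single_one_mul' k (fun j => a₀ j * (S.C * Ys * S.Cᵀ) j j)
      simpa only [mul_assoc] using this
    rw [hs, hq k] at h
    linarith
  -- (iv) nondegeneracy
  have hnondeg : 0 < trace Z₁₁ ∨ dualAdjP S Z₁₁ Z₂₁ + (dualAdjP S Z₁₁ Z₂₁)ᵀ ≠ 0 := by
    by_contra hcon
    obtain ⟨htr, hW⟩ := not_or.mp hcon
    have htr : trace Z₁₁ ≤ 0 := not_lt.mp htr
    have hW : dualAdjP S Z₁₁ Z₂₁ + (dualAdjP S Z₁₁ Z₂₁)ᵀ = 0 := not_ne_iff.mp hW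
    have htr0 : trace Z₁₁ = 0 := le_antisymm htr hZ11_psd.trace_nonneg
    have hζ0 : slotR f 1 = 0 := by linarith [hV1]
    have hYs0 : Ys = 0 := by
      have h2 : Ys + Ys = 0 := by rw [← hV4, hW]
      have h3 : (2 : ℝ) • Ys = 0 := by rw [two_smul, h2]
      rcases smul_eq_zero.mp h3 with h | h
      · norm_num at h
      · exact h
    have hZ11_0 : Z₁₁ = 0 := eq_zero_of_posSemidef_of_trace_eq_zero hZ11_psd htr0
    have hZ21_0 : Z₂₁ = 0 := by
      have hpsd : (fromBlocks (0 : Matrix ι ι ℝ) Z₂₁ᵀ Z₂₁ᵀᵀ Z₂₂).PosSemidef := by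
        rw [transpose_transpose, ← hZ11_0, hblocks]
        exact hZs_psd
      have h1 := ((Literature.Computation.Certificates.PsdZeroPivotRule.posSemidef_fromBlocks_zero₁₁_iff
        _ _).mp hpsd).1
      have h2 := congrArg Matrix.transpose h1
      rwa [transpose_transpose, transpose_zero] at h2
    have hZ22_diag : ∀ k, Z₂₂ k k = 0 := by
      intro k
      have ht := hV2 k
      have hν := hν_nonneg k
      have htk : dualSectorCoeff S Z₁₁ Z₂₁ Z₂₂ a₀ b₀ k = -(Z₂₂ k k) := by
        simp [dualSectorCoeff, hZ11_0, hZ21_0]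
      have hd : 0 ≤ Z₂₂ k k := hZ22_psd.diag_nonneg
      linarith
    have hZ22_0 : Z₂₂ = 0 :=
      eq_zero_of_posSemidef_of_trace_eq_zero hZ22_psd (by simp [Matrix.trace, hZ22_diag])
    have hZs0 : Zs = 0 := by
      rw [← hblocks, hZ11_0, hZ21_0, hZ22_0, transpose_zero, fromBlocks_zero]
    have hν0 : ∀ k, slotW f (Pi.single k 1) = 0 := by
      intro k
      have ht := hV2 k
      have htk : dualSectorCoeff S Z₁₁ Z₂₁ Z₂₂ a₀ b₀ k = 0 := by
        simp [dualSectorCoeff, hZ11_0, hZ21_0, hZ22_0]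
      linarith
    have hμ0 : ∀ k, slotV f (Pi.single k 1) = 0 := by
      intro k
      have hs := hV3 k
      have hsk : dualPopovCoeff S Z₂₁ Z₂₂ k = 0 := by
        simp [dualPopovCoeff, hZ21_0, hZ22_0]
      have hqk : dualLowerCoeff S Z₁₁ Z₂₁ k = 0 := by
        simp [dualLowerCoeff, dualAdjP, hZ11_0, hZ21_0]
      rw [hsk, hqk] at hs
      linarith
    have hsum1 : (1 : κ → ℝ) = ∑ k, Pi.single k (1 : ℝ) := by
      conv_lhs => rw [← Finset.univ_sum_single (1 : κ → ℝ)]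
      simp only [Pi.one_apply]
    have hV1' : slotV f 1 = 0 := by
      rw [hsum1, map_sum]
      exact Finset.sum_eq_zero fun k _ => hμ0 k
    have hW1' : slotW f 1 = 0 := by
      rw [hsum1, map_sum]
      exact Finset.sum_eq_zero fun k _ => hν0 k
    have hZ1' : slotZ f 1 = 0 := by
      have h := hZpair 1 transpose_one
      rw [hZs0, Matrix.zero_mul, trace_zero] at h
      linarith
    have hP1' : slotP f 1 = 0 := by
      have h := hYpair 1 transpose_one
      rw [hYs0, Matrix.zero_mul, trace_zero] at h
      linarith
    have hc₀0 : f (1, 1, 1, 1, 1) = 0 := by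
      rw [apply_eq_slots, hZ1', hV1', hW1', hP1', hζ0]
      ring
    linarith
  -- (v) the witness
  have hpsd : (fromBlocks Z₁₁ Z₂₁ᵀ Z₂₁ Z₂₂).PosSemidef := by
    rw [hblocks]
    exact hZs_psd
  have hadj : (dualAdjP S Z₁₁ Z₂₁ + (dualAdjP S Z₁₁ Z₂₁)ᵀ).PosSemidef := by
    rw [hV4]
    exact hYs_psd.add hYs_psd
  have hsec : ∀ k, 0 ≤ dualSectorCoeff S Z₁₁ Z₂₁ Z₂₂ a₀ b₀ k := fun k => by
    rw [hV2 k]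
    exact mul_nonneg (by norm_num) (hν_nonneg k)
  have hlow : ∀ k, a₀ k * dualLowerCoeff S Z₁₁ Z₂₁ k ≤ 2 * dualPopovCoeff S Z₂₁ Z₂₂ k :=
    fun k => by
      rw [hV3 k]
      linarith [hμ_nonneg k]
  exact ⟨⟨Z₁₁, Z₂₁, Z₂₂, hpsd, hadj, hsec, hlow, hnondeg⟩⟩

/-- **Exactness of the LP dual lane**: the positivity class at slopes `(a₀, b₀)` is empty IFF an LP
Farkas witness exists. [cite: BoydVandenberghe2004, §5.9.4 (5.99)–(5.100) and Example 5.14] -/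
theorem lp_isEmpty_iff_nonempty_lpFarkasWitness :
    IsEmpty {Λ : LPSlabCertificate S // Λ.a = a₀ ∧ Λ.b = b₀} ↔
      Nonempty (LPSlabFarkasWitness S a₀ b₀) :=
  ⟨exists_lpFarkasWitness_of_isEmpty S a₀ b₀,
    fun ⟨D⟩ => LPSlabCertificate.isEmpty_of_lpFarkasWitness D⟩

/-- Existential form. [cite: BoydVandenberghe2004, §5.9.4 (5.99)–(5.100) and Example 5.14] -/
theorem exists_lpSlabCertificate_iff_not_nonempty_lpFarkasWitness :
    (∃ Λ : LPSlabCertificate S, Λ.a = a₀ ∧ Λ.b = b₀) ↔ ¬ Nonempty (LPSlabFarkasWitness S a₀ b₀) := by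
  rw [← lp_isEmpty_iff_nonempty_lpFarkasWitness, not_isEmpty_iff]
  exact ⟨fun ⟨Λ, hΛ⟩ => ⟨⟨Λ, hΛ⟩⟩, fun ⟨⟨Λ, hΛ⟩⟩ => ⟨Λ, hΛ⟩⟩

/-- **THE THEOREM OF ALTERNATIVES for the positivity class**: for every Lur'e system `S` and all
slopes `(a₀, b₀)`, EXACTLY ONE of — (i) an `LPSlabCertificate S` with sectors `[a₀_k, b₀_k]` exists;
(ii) an `LPSlabFarkasWitness S a₀ b₀` exists.
[cite: BoydVandenberghe2004, §5.9.4 «strong alternatives» (5.99)–(5.100) (with §5.8.2 p. 260 for the term) and Example 5.14] -/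
theorem lpSlabCertificate_xor_lpFarkasWitness :
    Xor (Nonempty {Λ : LPSlabCertificate S // Λ.a = a₀ ∧ Λ.b = b₀})
      (Nonempty (LPSlabFarkasWitness S a₀ b₀)) := by
  rcases isEmpty_or_nonempty {Λ : LPSlabCertificate S // Λ.a = a₀ ∧ Λ.b = b₀} with h | h
  · exact Or.inr ⟨exists_lpFarkasWitness_of_isEmpty S a₀ b₀ h, not_nonempty_iff.mpr h⟩
  · exact Or.inl ⟨h, fun ⟨D⟩ => (LPSlabCertificate.isEmpty_of_lpFarkasWitness D).false h.some⟩

/-- **Lane inclusion at the level of alternatives**: if the class of record is non-empty at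
`(a₀, b₀)`, so is the positivity class (by `SlabCertificate.toLP`), hence no LP Farkas witness exists.
[cite: Khalil2002, §7.1 Example 7.5 (loop transformation widens the class); BoydVandenberghe2004, §5.9.4] -/
theorem not_nonempty_lpFarkasWitness_of_slabCertificate (Λ : SlabCertificate S)
    (ha : Λ.a = a₀) (hb : Λ.b = b₀) : ¬ Nonempty (LPSlabFarkasWitness S a₀ b₀) :=
  fun ⟨D⟩ => Λ.false_of_lpFarkasWitness D ha hb

end Main

end Literature.MathematicalPhysics.PowerSystems.LyapunovFunctionFamily
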